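import Summits.CriticalPhenomena.PercolationContinuityZ3.Theorems.PercNearOneGluingNoHeavyLowerTailSwitchRelaxCheck
import HarnessLib

/-!
# `NoHeavyLowerTail` (stmt-CriticalPhenomena-4575) — finite-relaxation replay of switching certificates: entry tables split by
# the input type of the explored copy

Support file (prover prim-masterthm-p1 gen 2; `--supports stmt-CriticalPhenomena-4575`).  No named facts, no sorries.

Certificates whose input potential `λ₀(type X, type Y, type Z)` has many entries (the clean three-copy certificates of the
4-point increasing cubic rows found by prim-masterthm-p1's separable exact LP have 700–1 300) are kernel-checked much faster when
`λ₀` is stored as fifteen pair tables, one per `X`-type (`λ₀ r s t = lookup2 (table r) s t`), instead of one long list read by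
`lookup3` (`…SwitchRelaxCheck`).  The expectation identity of `…SwitchRelaxExpectation` (`sum3_eq_entries`) wants the single-list
form; this file provides the bridge: `lookup3_append` and `lookup3_map_tag`
(`lookup3` of a tagged pair list reads the pair list at the tag and vanishes elsewhere).
-/

namespace Summit.CriticalPhenomena.PercolationContinuityZ3.Theorems

namespace SwitchRelax

/-- `lookup3` is additive over list append. [folklore] -/
theorem lookup3_append (l₁ l₂ : List (Ty × Ty × Ty × ℤ)) (r s t : Ty) :
    lookup3 (l₁ ++ l₂) r s t = lookup3 l₁ r s t + lookup3 l₂ r s t := by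
  simp [lookup3, List.map_append, List.sum_append]

/-- `lookup3` on a pair list tagged with the `X`-type `k` (entries `(s, t, v) ↦ (k, s, t, v)`) is `lookup2` of the pair list when
`r = k` and `0` otherwise. [folklore] -/
theorem lookup3_map_tag (k : Ty) (l : List (Ty × Ty × ℤ)) (r s t : Ty) :
    lookup3 (l.map fun e => (k, e.1, e.2.1, e.2.2)) r s t = if r = k then lookup2 l s t else 0 := by
  induction l with
  | nil => simp [lookup3, lookup2]
  | cons e l ih =>
    simp only [lookup3, lookup2, List.map_cons, List.sum_cons] at ih ⊢
    by_cases h : r = k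
    · subst h; simp only [true_and, if_true] at ih ⊢; rw [ih]
    · have h' : ¬ (k = r) := fun hk => h hk.symm
      simp only [h', false_and, if_false, zero_add, h] at ih ⊢; exact ih


/-- `lookup3` on a pair list tagged with the `X`-type `k` by `Prod.mk k` (the simp-normal form of the tagging map) is `lookup2`
of the pair list when `r = k` and `0` otherwise. [folklore] -/
theorem lookup3_map_mk (k : Ty) (l : List (Ty × Ty × ℤ)) (r s t : Ty) :
    lookup3 (l.map (Prod.mk k)) r s t = if r = k then lookup2 l s t else 0 :=
  lookup3_map_tag k l r s t

end SwitchRelax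

end Summit.CriticalPhenomena.PercolationContinuityZ3.Theorems
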